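import Summits.Schanuel.Schanuel.Theorems.RootDecomp1BRadicalDescent05
import Summits.Schanuel.Schanuel.Theorems.RootDecomp1BSRLLogLiouville01
import Summits.Schanuel.Schanuel.Theorems.RootDecomp1KHyper06
import Summits.Schanuel.Schanuel.Theorems.RootDecomp1KFiniteOrderCell02

/-!
# RootDecomp1BMovingZero — lens 4, generation 35 «AX-TRANSVERSAL MOVING ZERO» (decomposition node: the (1 | ρ) storey of X below ultra ⟸ IsolatedIntersection ∧ ApproxOfIsolated) — part 1 (RootDecomp1BMovingZero01): §1 the typed pieces T = `IsolatedIntersection`, M′ = `ApproxOfIsolated`, `MovingZeroApprox`, glue `movingZeroApprox_of`, controls; §2 `algebraicIndependent_triple` and the defect dichotomy D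

PORT NOTE (census-1 gen 16, 2026-08-31): port of [HOME/decomp-schanuel-lens-4/g35/MovingZero.lean sha256 6d06e993…1960, 629 l + MovingZeroProbe 83779325… + MovingZeroCtrl 5b99b81a… + NODE.md 7a036a2d…; NOTE/CLAIM L1791, ACK + CHECKLIST B-g35 L1797, NODE L1816 / REQUEST L1817]; own farm rc 0 · 0 warn · 0 sorry · axioms std;
critic VERDICT L1819: CLEARED as lens-4's g35 DECOMPOSITION node of record (no credit claimed or awarded; label NEW-COMBINATION; T/M′ UNDECIDED with discharge conditions (δ); PORT GO LOW `--supports stmt-Schanuel-32406`). A DECOMPOSITION node (critic L1797: admissible; cell NOT decided): for every real ρ with `LiouvilleOrder 8 ρ`,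
Cell `((2+2:ℕ):Cardinal) ≤ polarDeg ![1, ρ]` ⟸ S1[tree] ∧ D ∧ T ∧ M′ ∧ hX[tree statement `ExplicitRatExpApprox`] ∧ hLW[tree `LWMeasure`], with D, the glue
`movingZeroApprox_of : T → M′ → MovingZeroApprox ρ` and the endgame PROVED, and the two pieces T = `IsolatedIntersection ρ`, M′ = `ApproxOfIsolated ρ` typed as closed
`def … : Prop` (UNDECIDED, paper proofs in NODE.md §3; each proved as typed = a THEOREM credit, cell credit B-R22 (a) when both close). Two parts: 01 = §1 the typed
pieces (`triple`, `relEval`, `IsRelationPair`, `IsolatedAt`, `ApproxData`, `IsolatedIntersection`, `ApproxOfIsolated`, `MovingZeroApprox`, glue, strong form, genuineness controls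
`isolatedAt_one` / `not_isolatedAt_zero`) + §2 `algebraicIndependent_triple` (tree S1 re-indexed) and the defect dichotomy D (`isAlgebraic_pair_of_lt_four`, `exists_relationPair_of_lt_four`);
02 = §3 the endgame `four_le_polarDeg_of_movingZero (hLW) (hX) (hρ : LiouvilleOrder 8 ρ) (hMZ)` + §4 the cells at (1|ρ) below ultra (`four_le_polarDeg_one_of_movingZero`, swapped
ordering, `_of_pieces`, hyper, literal X-body, At-cells of 32406/32407/32408, 1K shapes 33363/33364) and members `rhoT = towerNumber 9` / `lambdaH`. PORT EDITS: the source's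
`log_sixteen_lt_three` is the tree's `RootDecomp1KHyper06` lemma (deleted, opened by name); `one_lt_log_sixteen` / `log_exp_I` / `log_exp_one` / `C₀rat_nonneg` private; four one-line
docstrings added; `set_option linter.dupNamespace false` dropped; statements and proofs otherwise verbatim; NO Theses import (the LIVE links live in the HOME probe).
`--supports stmt-Schanuel-32406` (per VERDICT L1819 (ε); the file is split in two because of the 398-line cap); no census credit carried; nothing here proves Schanuel; rung 0. The lens's header follows.
-/

/-!
# RootDecomp1B · lens 4 (minimal-counterexample / extremal reduction) · generation 35 —
# «AX-TRANSVERSAL MOVING ZERO»: the `(1 | ρ)` storey BELOW ULTRA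

Route `route-Schanuel-RootDecomp1B` (DRAFT rev 32), live target
X = `Summit.Schanuel.Schanuel.Theses.RootDecomp1B.KleinPolarSchanuel` (stmt-Schanuel-24622):
«every ℚ-free real `m`-tuple `r` has polar degree `t(r) = trdeg ℚ(r, ir, e^r, e^{ir}) ≥ 2m`».

TARGET (critic rule B-R22 (a)): X(2) AT `r = (1, ρ)` — `t(1, ρ) = trdeg ℚ(ρ, e, e^i, e^ρ, e^{iρ}) ≥ 4` — for `ρ`
HYPER-Liouville (`RootDecomp1KHyper.HyperCell.HyperLiouville`) and for `ρ` of FINITE exponential order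
(`RootDecomp1KGeneric.LiouvilleOrder 8`).  The tree decides the `(1 | ρ)` storey ONLY at ULTRA-Liouville `ρ`
(`RootDecomp1BRadicalDescent05.four_le_polarDeg_one_ultra`, radical descent + Ably's measure, additive
`exp(C D² log D)`); no measure of algebraic independence of the Lindemann–Weierstrass PAIR `(e, e^i)` polynomial
in the degree is in print, which is what blocks descent below ultra.

## The engine (no measure of the pair at all)

In a counterexample `e^ρ` and `e^{iρ}` are ALGEBRAIC over `M = ℚ(ρ, e, e^i)` (`trdeg M = 3`, tree:
`RootDecomp1BSRLLogLiouville01.algebraicIndependent_option_exp_of_LW`, mod `hLW`; §2–§3 below, PROVED).  Let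
`Σ_k G₁ₖ(ρ, e, e^i) (e^ρ)^k = 0`, `Σ_k G₂ₖ(ρ, e, e^i) (e^{iρ})^k = 0` be integer relations with non-zero top
coefficients (`RootDecomp1KHyper.exists_int_mvrelation`).  Two typed pieces, both free of any Liouville /
transcendence-measure hypothesis:

* `IsolatedIntersection ρ` (T): the plane analytic curves `𝒞₁ = {Σ G₁ₖ(ρ,X,Y) X^{kρ} = 0}`,
  `𝒞₂ = {Σ G₂ₖ(ρ,X,Y) Y^{kρ} = 0}` (principal branches) meet at `θ = (e, e^i)` in an ISOLATED point.
  Paper proof (NODE.md §T): on a common branch the exponents `log X, log Y, ρ log X, ρ log Y` feed Ax's theorem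
  (tree: `Literature.NumberTheory.Transcendental.ax_schanuel`, PROVED `ax_schanuel_holds`): `trdeg ≥ 5` against
  `≤ 4`, unless the branch is a `ℚ(ρ)`-special log-line `A log X + B log Y = κ`; the five special cases die by
  the algebraic independence of `e^{s}, e^{ρ s}, e^{ρ² s}` resp. by `trdeg M = 3`.
* `ApproxOfIsolated ρ` (M′): an isolated intersection MOVES — for `p/q → ρ` the curves with `ρ` replaced by `p/q`
  have a common zero `(X_q, Y_q)` with `|X_q − e| ≤ C|ρ − p/q|^κ` (Rouché in `ℂ²`, Łojasiewicz), and
  `(X_q, Y_q, X_q^{p/q}, Y_q^{p/q})` is an ISOLATED point of the ℚ-variety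
  `{Σ G₁ₖ(p/q,X,Y)U^k = 0, Σ G₂ₖ(p/q,X,Y)V^k = 0, U^q = X^p, V^q = Y^p}` (branch pinning + upper semicontinuity
  of fibre dimension), hence `X_q ∈ ℚ̄` with `deg ≤ c₁ q²`, `log M ≤ c₂ q² log(q+1)` (Bézout + arithmetic Bézout).
  Paper proof: NODE.md §M′.  The two pieces are joined in `MovingZeroApprox ρ` (= the Diophantine OUTPUT only,
  in the currency of `ExplicitRatExpApprox`: `C, κ, c₁, c₂, q₀`; PROVED `movingZeroApprox_of : T → M′ → MZ`).

ENDGAME (§3, PROVED): the tree fact `RootDecomp1KHyper.HyperCell.ExplicitRatExpApprox` (Waldschmidt 1978: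
approximation measure of `e = e^1` by algebraic `ξ`, POLYNOMIAL in the degree) at `r = 1` gives
`exp(−4 C₀(1) n² Y) ≤ |e − X_q| ≤ C|ρ − p/q|^κ < C e^{−κ q⁸}` with `4 C₀(1) n² Y ≤ K q⁷` — absurd at exponential
order 8 (numeral; one order of slack, see `four_le_polarDeg_of_movingZero`).

## What this file proves (0 `sorry`)

§1 the typed pieces + `movingZeroApprox_of : IsolatedIntersection ρ → ApproxOfIsolated ρ → MovingZeroApprox ρ`;
§2 `trdeg ℚ(ρ, e, e^i) = 3` for Liouville `ρ` (reindexing of the tree's S1), the defect dichotomy D and the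
existence of a relation pair in a counterexample (for ANY real tuple whose polar field holds the five numbers);
§3 `four_le_polarDeg_of_movingZero (hLW) (hX) (hρ : LiouvilleOrder 8 ρ) (hMZ : MovingZeroApprox ρ)` for every
such tuple, and its instances at `(1, ρ)` and — DERIVED — at `(ρ, 1)`;
§4 the cells: hyper-Liouville corollary, X(2)'s verbatim body, the At-cells of items 32406 / 32407 / 32408 at
`(1 | ρ)`, the `n = 4` instances of 1K's items 33363 / 33364 at `z = (1, ρ, i, iρ)`, members
(`towerNumber 9`: order 8, NOT hyper-, NOT ultra-Liouville — outside every earlier `(1 | u)` cell; `λ_H`).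
Hypotheses carried BY NAME: `hLW : LWMeasure` (Ably 1994, registered fact, as in every 1B storey-two cell),
`hX : ExplicitRatExpApprox` (PROVABLE support statement of 1K, = the tree theorem
`Waldschmidt1978.approx_measure_exp_alg` at `β = 1`), and the piece `hMZ : MovingZeroApprox ρ` (= T ∧ M′, OPEN,
typed here, tagged ATTACKABLE).
-/

noncomputable section

open Complex Polynomial

namespace Summit.Schanuel.Schanuel.Theorems.RootDecomp1BMovingZero

open Summit.Schanuel.Schanuel.Theorems.RootDecomp1KHyper (LWMeasure exists_int_mvrelation)
open Summit.Schanuel.Schanuel.Theorems.RootDecomp1KHyper.HyperCell (log_sixteen_lt_three HyperLiouville lambdaH hyperLiouville_lambdaH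
  ExplicitRatExpApprox C₀rat)
open Summit.Schanuel.Schanuel.Theorems.RootDecomp1KGeneric (LiouvilleOrder)
open Summit.Schanuel.Schanuel.Theorems.RootDecomp1KFiniteOrderCell (towerNumber liouvilleOrder_towerNumber
  not_hyperLiouville_towerNumber towerNumber_pos liouville_towerNumber)
open Summit.Schanuel.Schanuel.Theorems.RootDecomp1BFedFlagCore (KleinIH polarDeg polarField coe_mem_polarField
  exp_coe_mem_polarField exp_coe_mul_I_mem_polarField coe_mul_I_mem_polarField)
open Summit.Schanuel.Schanuel.Theorems.RootDecomp1BDefectFloorDefs (SharpRelativeLindemannAt TameDefectZeroAt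
  WildSharpDefectZeroAt WildSharpDefectZeroInitAt)
open Summit.Schanuel.Schanuel.Theorems.RootDecomp1BDefectFloorCells (natCast_le_trdeg_of_algebraicIndependent)
open Summit.Schanuel.Schanuel.Theorems.RootDecomp1BRadicalDescent (UltraLiouville isAlgebraic_base
  linearIndependent_base four_le_polarDeg_one_ultra linearIndependent_one_of_irrational)
open Summit.Schanuel.Schanuel.Theorems.RootDecomp1BSRLLogLiouville (algebraicIndependent_option_exp_of_LW)

/-! ## §1  The typed pieces -/

/-- The base triple `(ρ, e, e^i)` of the storey `(1 | ρ)`. -/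
def triple (ρ : ℝ) : Fin 3 → ℂ := ![(ρ : ℂ), cexp 1, cexp Complex.I]

/-- The relation polynomial `Σ_k G_k(t, X, Y) W^k` of an integer coefficient family `G`, evaluated. -/
def relEval {K : ℕ} (G : Fin (K + 1) → MvPolynomial (Fin 3) ℤ) (t X Y W : ℂ) : ℂ :=
  ∑ k : Fin (K + 1), MvPolynomial.aeval ![t, X, Y] (G k) * W ^ (k : ℕ)

/-- A RELATION PAIR at `ρ`: integer relations of `e^ρ` and of `e^{iρ}` over `ℤ[ρ, e, e^i]`, each with a non-zero
top coefficient (the output shape of `exists_int_mvrelation`). -/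
def IsRelationPair (ρ : ℝ) {K₁ K₂ : ℕ} (G₁ : Fin (K₁ + 1) → MvPolynomial (Fin 3) ℤ)
    (G₂ : Fin (K₂ + 1) → MvPolynomial (Fin 3) ℤ) : Prop :=
  G₁ (Fin.last K₁) ≠ 0 ∧ relEval G₁ ρ (cexp 1) (cexp Complex.I) (cexp ρ) = 0 ∧
    G₂ (Fin.last K₂) ≠ 0 ∧ relEval G₂ ρ (cexp 1) (cexp Complex.I) (cexp (ρ * Complex.I)) = 0

/-- The two plane analytic curves `𝒞₁ = {Σ_k G₁ₖ(ρ, X, Y) X^{kρ} = 0}`, `𝒞₂ = {Σ_k G₂ₖ(ρ, X, Y) Y^{kρ} = 0}`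
(principal branches `X^ρ = exp(ρ log X)`) meet at `θ = (e, e^i)` in an ISOLATED point. -/
def IsolatedAt (ρ : ℝ) {K₁ K₂ : ℕ} (G₁ : Fin (K₁ + 1) → MvPolynomial (Fin 3) ℤ)
    (G₂ : Fin (K₂ + 1) → MvPolynomial (Fin 3) ℤ) : Prop :=
  ∃ ε : ℝ, 0 < ε ∧ ∀ X Y : ℂ, ‖X - cexp 1‖ < ε → ‖Y - cexp Complex.I‖ < ε →
    relEval G₁ ρ X Y (cexp (ρ * Complex.log X)) = 0 → relEval G₂ ρ X Y (cexp (ρ * Complex.log Y)) = 0 →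
      X = cexp 1 ∧ Y = cexp Complex.I

/-- ALGEBRAIC APPROXIMATION DATA at `ρ` — the ONLY Diophantine output the endgame consumes, in the currency of
`ExplicitRatExpApprox`: constants `C, κ > 0`, `c₁, c₂`, a threshold `q₀`, and for every rational `r = p/q` with
`q ≥ q₀` and `|ρ − r| < e^{−q}` an algebraic number `ξ` (root of an irreducible integer `Q` of degree `n ≥ 1`) with
`n ≤ c₁ q²`, `log M(Q) ≤ c₂ q² log(q + 1)` and `|e − ξ| ≤ C |ρ − r|^κ`.  (q-exponents are NUMERALS; `κ` real;
nothing analytic.  The smallness threshold `e^{−q}` — any `e^{−q^a}`, `a ≥ 1`, would do — is the regime the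
moving-zero construction owns; the order-`m₀` approximants of the endgame satisfy it.) -/
def ApproxData (ρ : ℝ) : Prop :=
  ∃ C κ : ℝ, 0 < C ∧ 0 < κ ∧ ∃ c₁ c₂ : ℝ, ∃ q₀ : ℕ, ∀ r : ℚ, q₀ ≤ r.den →
    |ρ - r| < Real.exp (-(r.den : ℝ)) →
      ∃ (Q : ℤ[X]) (ξ : ℂ), Irreducible Q ∧ 0 < Q.natDegree ∧ aeval ξ Q = 0 ∧
        (Q.natDegree : ℝ) ≤ c₁ * (r.den : ℝ) ^ 2 ∧
          Real.log (Q.map (Int.castRingHom ℂ)).mahlerMeasure ≤ c₂ * (r.den : ℝ) ^ 2 * Real.log ((r.den : ℝ) + 1) ∧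
            ‖cexp 1 - ξ‖ ≤ C * |ρ - r| ^ κ

/-- **PIECE T (typed, OPEN, ATTACKABLE — Ax 1971 / tree `ax_schanuel_holds`).**  `IsolatedIntersection ρ`:
if `(ρ, e, e^i)` is algebraically independent, every relation pair has an isolated intersection at `(e, e^i)`. -/
def IsolatedIntersection (ρ : ℝ) : Prop :=
  AlgebraicIndependent ℚ (triple ρ) →
    ∀ (K₁ K₂ : ℕ) (G₁ : Fin (K₁ + 1) → MvPolynomial (Fin 3) ℤ) (G₂ : Fin (K₂ + 1) → MvPolynomial (Fin 3) ℤ),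
      IsRelationPair ρ G₁ G₂ → IsolatedAt ρ G₁ G₂

/-- **PIECE M′ (typed, OPEN, ATTACKABLE — Rouché in `ℂ²` + semicontinuity of fibre dimension + arithmetic
Bézout).**  `ApproxOfIsolated ρ`: an isolated intersection of a relation pair MOVES to algebraic approximations. -/
def ApproxOfIsolated (ρ : ℝ) : Prop :=
  AlgebraicIndependent ℚ (triple ρ) →
    ∀ (K₁ K₂ : ℕ) (G₁ : Fin (K₁ + 1) → MvPolynomial (Fin 3) ℤ) (G₂ : Fin (K₂ + 1) → MvPolynomial (Fin 3) ℤ),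
      IsRelationPair ρ G₁ G₂ → IsolatedAt ρ G₁ G₂ → ApproxData ρ

/-- **PIECE MZ = T ∧ M′ glued (typed; the hypothesis of the cell).**  `MovingZeroApprox ρ`: if `(ρ, e, e^i)` is
algebraically independent and BOTH `e^ρ`, `e^{iρ}` are algebraic over `ℚ(ρ, e, e^i)`, the approximation data hold. -/
def MovingZeroApprox (ρ : ℝ) : Prop :=
  AlgebraicIndependent ℚ (triple ρ) →
    IsAlgebraic (Algebra.adjoin ℚ (Set.range (triple ρ))) (cexp ρ) →
      IsAlgebraic (Algebra.adjoin ℚ (Set.range (triple ρ))) (cexp (ρ * Complex.I)) → ApproxData ρ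

/-- GLUE (PROVED): T ∧ M′ ⟹ MZ — the relation pair is supplied by `exists_int_mvrelation`. -/
theorem movingZeroApprox_of {ρ : ℝ} (hT : IsolatedIntersection ρ) (hM : ApproxOfIsolated ρ) :
    MovingZeroApprox ρ := by
  intro h3 h1 h2
  obtain ⟨K₁, G₁, hG₁, hrel₁⟩ := exists_int_mvrelation h1
  obtain ⟨K₂, G₂, hG₂, hrel₂⟩ := exists_int_mvrelation h2
  have hP : IsRelationPair ρ G₁ G₂ := ⟨hG₁, hrel₁, hG₂, hrel₂⟩
  exact hM h3 K₁ K₂ G₁ G₂ hP (hT h3 K₁ K₂ G₁ G₂ hP)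

/-- The STRONGER, purely functional form of T actually established by the paper proof (NODE.md §3): the two
VALUE conjuncts of `IsRelationPair` are not used — only the non-vanishing top coefficients (and the a.i. triple). -/
def IsolatedIntersectionStrong (ρ : ℝ) : Prop :=
  AlgebraicIndependent ℚ (triple ρ) →
    ∀ (K₁ K₂ : ℕ) (G₁ : Fin (K₁ + 1) → MvPolynomial (Fin 3) ℤ) (G₂ : Fin (K₂ + 1) → MvPolynomial (Fin 3) ℤ),
      G₁ (Fin.last K₁) ≠ 0 → G₂ (Fin.last K₂) ≠ 0 → IsolatedAt ρ G₁ G₂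

/-- GLUE (PROVED): the strong functional form implies T. -/
theorem isolatedIntersection_of_strong {ρ : ℝ} (h : IsolatedIntersectionStrong ρ) : IsolatedIntersection ρ :=
  fun h3 K₁ K₂ G₁ G₂ hP => h h3 K₁ K₂ G₁ G₂ hP.1 hP.2.2.1

/-- POSITIVE planted instance of the isolatedness predicate (conclusion by absurdity: the constant pair `1, 1` has
no zeros at all), twin of the NEGATIVE control `not_isolatedAt_zero` below: `IsolatedAt` is decided both ways. -/
theorem isolatedAt_one (ρ : ℝ) :
    IsolatedAt ρ (fun _ : Fin (0 + 1) => (1 : MvPolynomial (Fin 3) ℤ)) (fun _ : Fin (0 + 1) => 1) := by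
  refine ⟨1, one_pos, fun X Y _ _ h1 _ => ?_⟩
  simp [relEval] at h1

/-- Readback: `IsolatedIntersection` is literally «a.i. triple → relation pair → isolated». -/
theorem isolatedIntersection_iff (ρ : ℝ) : IsolatedIntersection ρ ↔
    (AlgebraicIndependent ℚ (triple ρ) →
      ∀ (K₁ K₂ : ℕ) (G₁ : Fin (K₁ + 1) → MvPolynomial (Fin 3) ℤ) (G₂ : Fin (K₂ + 1) → MvPolynomial (Fin 3) ℤ),
        IsRelationPair ρ G₁ G₂ → IsolatedAt ρ G₁ G₂) := Iff.rfl

/-- Readback: `MovingZeroApprox` verbatim. -/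
theorem movingZeroApprox_iff (ρ : ℝ) : MovingZeroApprox ρ ↔
    (AlgebraicIndependent ℚ (triple ρ) →
      IsAlgebraic (Algebra.adjoin ℚ (Set.range (triple ρ))) (cexp ρ) →
        IsAlgebraic (Algebra.adjoin ℚ (Set.range (triple ρ))) (cexp (ρ * Complex.I)) → ApproxData ρ) := Iff.rfl

/-- Sanity of the branch convention: at the base point the principal powers ARE `e^ρ`, `e^{iρ}`
(`log e = 1`, `log e^i = i`), so `θ = (e, e^i)` lies on both curves of a relation pair. -/
private theorem log_exp_one : Complex.log (cexp 1) = 1 := by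
  rw [Complex.log_exp] <;> simp [Real.pi_pos.le, Real.pi_pos]

/-- `log (e^{i}) = i` (principal branch). -/
private theorem log_exp_I : Complex.log (cexp Complex.I) = Complex.I := by
  rw [Complex.log_exp] <;> simp <;> linarith [Real.pi_gt_three]

/-- The base point `(e, e^i)` lies on both relation curves of a relation pair. -/
theorem base_mem_curves (ρ : ℝ) {K₁ K₂ : ℕ} {G₁ : Fin (K₁ + 1) → MvPolynomial (Fin 3) ℤ}
    {G₂ : Fin (K₂ + 1) → MvPolynomial (Fin 3) ℤ} (h : IsRelationPair ρ G₁ G₂) :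
    relEval G₁ ρ (cexp 1) (cexp Complex.I) (cexp (ρ * Complex.log (cexp 1))) = 0 ∧
      relEval G₂ ρ (cexp 1) (cexp Complex.I) (cexp (ρ * Complex.log (cexp Complex.I))) = 0 := by
  rw [log_exp_one, log_exp_I, mul_one]
  exact ⟨h.2.1, h.2.2.2⟩

/-- NEGATIVE CONTROL for the genuineness conjunct of `IsRelationPair` (`G (Fin.last K) ≠ 0`): WITHOUT it the zero
families are a "relation pair" and their curves are the whole plane — NOT isolated.  (So T is false as a bare
statement about coefficient families; the top-coefficient conjunct + a.i. of the triple is what makes the relation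
polynomials have positive `W`-degree after specialising `t = ρ`.) -/
theorem not_isolatedAt_zero (ρ : ℝ) (K₁ K₂ : ℕ) :
    ¬ IsolatedAt ρ (fun _ : Fin (K₁ + 1) => (0 : MvPolynomial (Fin 3) ℤ))
      (fun _ : Fin (K₂ + 1) => (0 : MvPolynomial (Fin 3) ℤ)) := by
  rintro ⟨ε, hε, h⟩
  have h0 : ∀ {K : ℕ} (t X Y W : ℂ), relEval (fun _ : Fin (K + 1) => (0 : MvPolynomial (Fin 3) ℤ)) t X Y W = 0 := by
    intro K t X Y W; simp [relEval]
  have hX : ‖(cexp 1 + ε / 2 : ℂ) - cexp 1‖ < ε := by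
    have : (cexp 1 + ε / 2 : ℂ) - cexp 1 = ((ε / 2 : ℝ) : ℂ) := by push_cast; ring
    rw [this, Complex.norm_real, Real.norm_eq_abs, abs_of_pos (by positivity)]
    linarith
  have hY : ‖cexp Complex.I - cexp Complex.I‖ < ε := by simpa using hε
  have := (h (cexp 1 + ε / 2) (cexp Complex.I) hX hY (h0 _ _ _ _) (h0 _ _ _ _)).1
  have h2 : ((ε / 2 : ℝ) : ℂ) = 0 := by
    have h3 : (cexp 1 + ε / 2 : ℂ) - cexp 1 = 0 := by rw [this, sub_self]
    have h4 : (cexp 1 + ε / 2 : ℂ) - cexp 1 = ((ε / 2 : ℝ) : ℂ) := by push_cast; ring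
    rw [← h4, h3]
  have : (ε / 2 : ℝ) = 0 := by exact_mod_cast h2
  linarith

/-- The zero families are never a relation pair (the genuineness conjunct excludes them). -/
theorem not_isRelationPair_zero (ρ : ℝ) (K₁ K₂ : ℕ) :
    ¬ IsRelationPair ρ (fun _ : Fin (K₁ + 1) => (0 : MvPolynomial (Fin 3) ℤ))
      (fun _ : Fin (K₂ + 1) => (0 : MvPolynomial (Fin 3) ℤ)) := by
  rintro ⟨h, -⟩; exact h rfl

/-! ## §2  `trdeg ℚ(ρ, e, e^i) = 3` for Liouville `ρ` (tree S1, reindexed) and the defect dichotomy -/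

/-- `Fin.cons`-reindexing of an `Option`-indexed algebraically independent family. -/
theorem algebraicIndependent_cons_of_option {n : ℕ} {x : Fin n → ℂ} {a : ℂ}
    (h : AlgebraicIndependent ℚ (fun o : Option (Fin n) => o.elim a x)) :
    AlgebraicIndependent ℚ (Fin.cons a x : Fin (n + 1) → ℂ) := by
  have h' := h.comp _ (finSuccEquiv n).injective
  convert h' using 1
  funext i
  refine Fin.cases ?_ (fun j => ?_) i
  · simp
  · simp

/-- **S1 at the base `(1, i)`:** `(ρ, e, e^i)` is algebraically independent for every Liouville `ρ` (mod `hLW`). -/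
theorem algebraicIndependent_triple (hLW : LWMeasure) {ρ : ℝ} (hρ : Liouville ρ) :
    AlgebraicIndependent ℚ (triple ρ) := by
  have h := algebraicIndependent_cons_of_option
    (algebraicIndependent_option_exp_of_LW hLW isAlgebraic_base linearIndependent_base hρ)
  convert h using 1
  funext i
  refine Fin.cases ?_ (fun j => ?_) i
  · simp [triple]
  · refine Fin.cases ?_ (fun k => ?_) j
    · simp [triple]
    · refine Fin.cases ?_ (fun l => l.elim0) k
      simp only [triple, Fin.cons_succ, Matrix.cons_val_succ, Matrix.cons_val_zero]

/-- **DEFECT DICHOTOMY (one direction, PROVED):** if `(ρ, e, e^i)` is algebraically independent, the polar field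
`F(r)` of a real tuple `r` contains `ρ, e, e^i`, and some `a ∈ F(r)` is transcendental over `ℚ(ρ, e, e^i)`, then
`t(r) ≥ 4`. -/
theorem four_le_polarDeg_of_transcendental {ρ : ℝ} (h3 : AlgebraicIndependent ℚ (triple ρ)) {m : ℕ}
    {r : Fin m → ℝ} (hρr : (ρ : ℂ) ∈ polarField r) (he : cexp 1 ∈ polarField r)
    (hei : cexp Complex.I ∈ polarField r) {a : ℂ} (ha : a ∈ polarField r)
    (htr : Transcendental (Algebra.adjoin ℚ (Set.range (triple ρ))) a) :
    ((2 + 2 : ℕ) : Cardinal) ≤ polarDeg r := by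
  have hai : AlgebraicIndependent ℚ (Fin.cons a (triple ρ) : Fin (3 + 1) → ℂ) :=
    algebraicIndependent_cons_of_option ((h3.option_iff_transcendental a).mpr htr)
  refine natCast_le_trdeg_of_algebraicIndependent (L := polarField r) hai fun i => ?_
  refine Fin.cases ?_ (fun j => ?_) i
  · simpa using ha
  · rw [Fin.cons_succ]
    refine Fin.cases ?_ (fun k => ?_) j
    · simpa [triple] using hρr
    · refine Fin.cases ?_ (fun l => ?_) k
      · simpa [triple] using he
      · refine Fin.cases ?_ (fun o => o.elim0) l
        simpa [triple] using hei

/-- … so in a counterexample (`t(r) < 4` with `e^ρ, e^{iρ} ∈ F(r)` as well) BOTH `e^ρ` and `e^{iρ}` are algebraic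
over `ℚ(ρ, e, e^i)` … -/
theorem isAlgebraic_pair_of_lt_four {ρ : ℝ} (h3 : AlgebraicIndependent ℚ (triple ρ)) {m : ℕ} {r : Fin m → ℝ}
    (hρr : (ρ : ℂ) ∈ polarField r) (he : cexp 1 ∈ polarField r) (hei : cexp Complex.I ∈ polarField r)
    (heρ : cexp ρ ∈ polarField r) (heρi : cexp (ρ * Complex.I) ∈ polarField r)
    (h4 : ¬ ((2 + 2 : ℕ) : Cardinal) ≤ polarDeg r) :
    IsAlgebraic (Algebra.adjoin ℚ (Set.range (triple ρ))) (cexp ρ) ∧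
      IsAlgebraic (Algebra.adjoin ℚ (Set.range (triple ρ))) (cexp (ρ * Complex.I)) := by
  constructor
  · by_contra htr
    exact h4 (four_le_polarDeg_of_transcendental h3 hρr he hei heρ htr)
  · by_contra htr
    exact h4 (four_le_polarDeg_of_transcendental h3 hρr he hei heρi htr)

/-- … and hence a RELATION PAIR exists (exactness of the split: the hypotheses of T and M′ are met in every
counterexample). -/
theorem exists_relationPair_of_lt_four {ρ : ℝ} (h3 : AlgebraicIndependent ℚ (triple ρ)) {m : ℕ}
    {r : Fin m → ℝ} (hρr : (ρ : ℂ) ∈ polarField r) (he : cexp 1 ∈ polarField r)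
    (hei : cexp Complex.I ∈ polarField r) (heρ : cexp ρ ∈ polarField r)
    (heρi : cexp (ρ * Complex.I) ∈ polarField r) (h4 : ¬ ((2 + 2 : ℕ) : Cardinal) ≤ polarDeg r) :
    ∃ (K₁ K₂ : ℕ) (G₁ : Fin (K₁ + 1) → MvPolynomial (Fin 3) ℤ) (G₂ : Fin (K₂ + 1) → MvPolynomial (Fin 3) ℤ),
      IsRelationPair ρ G₁ G₂ := by
  obtain ⟨h1, h2⟩ := isAlgebraic_pair_of_lt_four h3 hρr he hei heρ heρi h4
  obtain ⟨K₁, G₁, hG₁, hrel₁⟩ := exists_int_mvrelation h1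
  obtain ⟨K₂, G₂, hG₂, hrel₂⟩ := exists_int_mvrelation h2
  exact ⟨K₁, K₂, G₁, G₂, hG₁, hrel₁, hG₂, hrel₂⟩

/-- The five generators `ρ, e, e^i, e^ρ, e^{iρ}` lie in the polar field of `(1, ρ)` … -/
theorem mem_polarField_one (ρ : ℝ) :
    (ρ : ℂ) ∈ polarField ![(1 : ℝ), ρ] ∧ cexp 1 ∈ polarField ![(1 : ℝ), ρ] ∧
      cexp Complex.I ∈ polarField ![(1 : ℝ), ρ] ∧ cexp ρ ∈ polarField ![(1 : ℝ), ρ] ∧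
        cexp (ρ * Complex.I) ∈ polarField ![(1 : ℝ), ρ] := by
  refine ⟨?_, ?_, ?_, ?_, ?_⟩
  · simpa using coe_mem_polarField ![(1 : ℝ), ρ] 1
  · simpa using exp_coe_mem_polarField ![(1 : ℝ), ρ] 0
  · simpa using exp_coe_mul_I_mem_polarField ![(1 : ℝ), ρ] 0
  · simpa using exp_coe_mem_polarField ![(1 : ℝ), ρ] 1
  · simpa using exp_coe_mul_I_mem_polarField ![(1 : ℝ), ρ] 1

/-- … and in the polar field of `(ρ, 1)` (the swapped ordering is DERIVED, not planted). -/
theorem mem_polarField_swap (ρ : ℝ) :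
    (ρ : ℂ) ∈ polarField ![ρ, (1 : ℝ)] ∧ cexp 1 ∈ polarField ![ρ, (1 : ℝ)] ∧
      cexp Complex.I ∈ polarField ![ρ, (1 : ℝ)] ∧ cexp ρ ∈ polarField ![ρ, (1 : ℝ)] ∧
        cexp (ρ * Complex.I) ∈ polarField ![ρ, (1 : ℝ)] := by
  refine ⟨?_, ?_, ?_, ?_, ?_⟩
  · simpa using coe_mem_polarField ![ρ, (1 : ℝ)] 0
  · simpa using exp_coe_mem_polarField ![ρ, (1 : ℝ)] 1
  · simpa using exp_coe_mul_I_mem_polarField ![ρ, (1 : ℝ)] 1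
  · simpa using exp_coe_mem_polarField ![ρ, (1 : ℝ)] 0
  · simpa using exp_coe_mul_I_mem_polarField ![ρ, (1 : ℝ)] 0

end Summit.Schanuel.Schanuel.Theorems.RootDecomp1BMovingZero

end
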